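import Summits.KontsevichZagierPeriods.KontsevichZagierPeriods.Theses.MultivaluedCoV
import Summits.KontsevichZagierPeriods.KontsevichZagierPeriods.Theorems.HurwitzMicroSectorsNormalFormPrincipleSplitGlue

/-!
# `MultiCoVKernelSplitGlue` (stmt-KontsevichZagierPeriods-17833, route MultivaluedCoV) — proof

`MultiCoVKernelSplitGlue : AyoubPiLocalKernel → AyoubPiCancellation → MultiCoVKernel`: the glue of
the crux-strategist's `[π]`-localisation split of the deciding crux `MultiCoVKernel`
(stmt-KontsevichZagierPeriods-2873; `ker eval ≤ closure ((1a) ∪ (1b) ∪ (3) ∪ multivalued-CoV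
relators)`) into the shared items `AyoubPiLocalKernel` (stmt-0541: for every pinned product
`P n r = [π] ⋆ r`, every value-zero formal combination becomes a KZ relation after finitely many
`P`-multiplications — Conjecture 1 for the period ring localised at `[π]`, Kontsevich–Zagier 2001
§4.1, Ayoub 2014 Def. 6 / Conj. 7) and `AyoubPiCancellation` (stmt-0540: `P`-multiplication
reflects relations; Huber–Wüstholz 2022 App. A.4).

This is the planner's published sorry-free proof (`Cruxes/MultiCoVKernel/Split.lean`, theorem
`MultiCoVKernel_of_subs`, and `Cruxes/MultiCoVKernel/GlueProof.lean`) re-homed under `Theorems/`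
by lead c10 of crux stmt-KontsevichZagierPeriods-9129 (banking), with its two auxiliary
definitions (`multiCoVRel`, `plusClosure`) inlined: the enlarged generator set is read off the
goal. Proof: a pinned product exists (`exists_pinnedProduct`,
Theorems/HurwitzMicroSectorsNormalFormPrincipleSplitGlue, so neither `∀ P`-hypothesis is consumed
vacuously); for `c ∈ ker eval` the `π`-local kernel gives `(lift (of ∘ P))^[N] c ∈ KZ.relations`;
`π`-cancellation peels the `N` factors (induction on `N`, left-nested iterates
`Function.iterate_succ_apply'`); and `KZ.relations ≤ closure (KZ⁺ generators)` generator by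
generator (`AddSubgroup.closure_le`), because rule (2) of the calculus IS the one-sheet (`N = 1`,
`σ₀ = r.domain`) multivalued change of variables — its ten side conditions are discharged one by
one (sheet semialgebraic = `r.isSemialgebraic_domain`; exhaustion and co-nullity are
`r.domain ∖ r.domain = ∅`, `Φ '' r.domain = r'.domain`; the integrand identity is the rule-(2)
identity under `Fin.sum_univ_one` / `Set.indicator_of_mem`; `[r] − 1 • [r'] = [r] − [r']`).
Sources: M. Kontsevich, D. Zagier, *Periods* (2001), §1.2 rule (2), §4.1; J. Ayoub, *Periods and
the conjectures of Grothendieck and Kontsevich–Zagier*, EMS Newsl. 91 (2014), Def. 6 / Conj. 7;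
A. Huber, G. Wüstholz, *Transcendence and linear relations of 1-periods* (2022), App. A.4.
[folklore]
-/

noncomputable section

namespace Summit.KontsevichZagierPeriods.MultivaluedCoV

open Set MeasureTheory
open Literature.NumberTheory.Transcendental

/-- **`MultiCoVKernelSplitGlue`** (route MultivaluedCoV, stmt-KontsevichZagierPeriods-17833):
`AyoubPiLocalKernel → AyoubPiCancellation → MultiCoVKernel`. Pinned product
(`exists_pinnedProduct`) → the `π`-local kernel gives `(lift (of ∘ P))^[N] c ∈ KZ.relations` for
`c ∈ ker eval` → `π`-cancellation peels the `N` factors (induction on `N`) → every KZ relation is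
a KZ⁺ relation, since (1a), (1b), (3) are generators of both and rule (2) is the one-sheet
multivalued change-of-variables relator. [Kontsevich–Zagier 2001, §1.2 rule (2), §4.1;
Ayoub 2014, Def. 6 and Conj. 7] [folklore] -/
theorem multiCoVKernelSplitGlue_proof :
    Summit.KontsevichZagierPeriods.KontsevichZagierPeriods.Theses.MultivaluedCoV.MultiCoVKernelSplitGlue := by
  unfold Summit.KontsevichZagierPeriods.KontsevichZagierPeriods.Theses.MultivaluedCoV.MultiCoVKernelSplitGlue
  intro h₁ h₂
  unfold Summit.KontsevichZagierPeriods.KontsevichZagierPeriods.Theses.MultivaluedCoV.AyoubPiLocalKernel at h₁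
  unfold Summit.KontsevichZagierPeriods.KontsevichZagierPeriods.Theses.MultivaluedCoV.AyoubPiCancellation at h₂
  unfold Summit.KontsevichZagierPeriods.KontsevichZagierPeriods.Theses.MultivaluedCoV.MultiCoVKernel
  -- a pinned product `[π] ⋆ ·` exists
  obtain ⟨P, hP⟩ :=
    Summit.KontsevichZagierPeriods.HurwitzMicroSectors.NormalFormPrincipleSplitGlue.exists_pinnedProduct
  intro c hc
  -- 0541: some `[π]^N ⋆ c` is a KZ relation
  obtain ⟨N, hN⟩ := h₁ P hP c hc
  -- 0540 peels the `N` factors `[π]`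
  have hrel : c ∈ KZ.relations := by
    clear hc
    induction N with
    | zero => simpa using hN
    | succ N ih =>
      exact ih (h₂ P hP _ (by simpa only [Function.iterate_succ_apply'] using hN))
  -- KZ relations are KZ⁺ relations, generator by generator
  refine (AddSubgroup.closure_le _).mpr ?_ hrel
  rintro d (((hd | hd) | hd) | hd)
  · exact AddSubgroup.subset_closure (Or.inl (Or.inl (Or.inl hd)))
  · exact AddSubgroup.subset_closure (Or.inl (Or.inl (Or.inr hd)))
  · -- rule (2) is the one-sheet (`N = 1`, `σ₀ = r.domain`) multivalued change of variables
    refine AddSubgroup.subset_closure (Or.inr ?_)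
    obtain ⟨n, r, r', Φ, Φ', hsa, hder, hinj, hdom, hf, rfl⟩ := hd
    refine ⟨n, 1, r, r', fun _ => r.domain, fun _ => Φ, fun _ => Φ',
      ?_, ?_, ?_, ?_, ?_, ?_, ?_, ?_, ?_, ?_⟩
    · intro _; exact r.isSemialgebraic_domain
    · intro _; exact Subset.rfl
    · simp [Set.iUnion_const]
    · intro _; exact hsa
    · intro _ x hx; exact hder x hx
    · intro _; exact hinj
    · intro _; rw [hdom]
    · intro _; simp [hdom]
    · intro x hx
      have hx' : x ∈ r.domain := by simpa [Set.iUnion_const] using hx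
      simp [Set.indicator_of_mem hx', hf x hx']
    · simp
  · exact AddSubgroup.subset_closure (Or.inl (Or.inr hd))

end Summit.KontsevichZagierPeriods.MultivaluedCoV
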